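import Mathlib
import HarnessLib
import Summits.HubbardSuperconductivity.HubbardSuperconductivity.Theorems.KLProgrammeC4aTangentialSoftness
import Summits.HubbardSuperconductivity.HubbardSuperconductivity.Theorems.KLProgrammeKLRegimeCountertermProfileSymmetry

/-!
# Route `KLProgramme` — crux C4a (inductive tangential bound): the CO-MOVING vocabulary of the induction (D1 of lane hubbard-kl-c4a-1)

Cell `gate-hubbard-kl`, lane hubbard-kl-c4a-1 (plan g15 (R24); memo HOME/hubbard-kl-c4a-1/C4A-PLAN.md §2c, §7).  Helper for the ENGINE
item stmt-HubbardSuperconductivity-20236 (sixth stub: angular jets `k = 2 … 4` of the scale-`n` local-part increment, DECOMP C4a-reg).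

WHAT THE INDUCTION CARRIES.  A tangential derivative of the one-slice tadpole `θ ↦ Σ_q g_n(q) V(k_F(θ), q)` that drives the two-leg
increment is — after the FS-adapted change of variables `q = Φ(ρ, ϑ)`, `e_K(Φ(ρ, ϑ)) = ρ`, `ϑ ↦ ϑ + θ` (FST II Thm 3.5's change of variables,
FST III §3.6 [arXiv:cond-mat/9705272 p.147]) — a derivative along the CO-MOVING field: the external leg and the loop leg are shifted by the
same angle.  The slice propagator, a function of `(q₀, e_K(q))`, is then EXACTLY constant (§2: `profile_coMoving_const`), and everything a
tangential derivative sees is the co-moving jet of the (fat) four-leg vertex `V`.  The invariant the all-orders induction must thread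
(memo (J_n)) is therefore: the regular part of the tadpole-restricted fat vertex has BOUNDED CO-MOVING JETS with `n`-free constants
(`CoMovingJets`, §3) — true for the explicit bubbles because the co-moving field is tangent to their singular manifolds `q = ±k` (adaptive /
conormal smoothness), false only at the umklapp corners, where momentum conservation modulo `G` pins a loop momentum to `p₁` (`3p₁ ≡ k*`),
which does not co-move (rate `α = n(p₁)·t(k*)`): the per-scale corner log of DECOMP App. C and the sharp `4^{(k−2)n}` law (memo §2b/§4).

* §1 `levelPoint μ K ρ ϑ` — the point at polar angle `ϑ` on the level curve `{e_K = ρ}` of the frame band, i.e. the Fermi point of the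
  SAME frame at chemical potential `μ + ρ` (no new object: `klFermiPoint (μ + ρ) K ϑ`); `frameLevel_levelPoint` (`e_K ∘ Φ(ρ, ·) ≡ ρ` under
  the band hypotheses), `levelPoint_add_pi` (central symmetry `Φ(ρ, ϑ + π) = −Φ(ρ, ϑ)`, from the tree's `KLRegimeSplit.klFermiPoint_add_pi`).
* §2 `coMoving μ K V θ ρ ϑ : ℝ → ℂ` — the co-moving reading `t ↦ V(Φ(0, θ + t), Φ(ρ, ϑ + t))`; `profile_coMoving_const`: a profile of the
  level read on the loop leg, `t ↦ f(e_K(Φ(ρ, ϑ + t)))`, is the constant `f ρ` (exact softness, cf. `…C4aTangentialSoftness` for the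
  `O(‖P‖)` version in Cartesian routing); `coMoving_cooper` : at `ϑ = θ + π` the loop leg is `−Φ(ρ, θ + t)`, the Cooper configuration
  co-moves.
* §3 `CoMovingJets A r μ K V` — `∀ θ ρ ϑ, |ρ| ≤ r →` the co-moving reading is `C⁴` with `‖∂ₜʲ‖ ≤ A j` (`j ≤ 4`) at `t = 0`.

Definitions + elementary lemmas; nothing is asserted about the Hubbard model.  NOT here (deliberately): the caustic/corner piece (sub-lemma
(L4), p2 lineage's second-order corner files), the tadpole-jet lemma itself ((L2): Jacobian of `Φ`, `q₀`-sum, lattice-vs-continuum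
aliasing), and the per-scale step `C4aStep` (keyed to the v4 binders of 20236 once registered).
References: FST II CPAM 51 (1998) 1133 Thm 3.5; FST III CPAM 52 (1999) 273 §3.6; BGM 2006 §2.4 Lemma 2.1 [cite: BenfattoGiulianiMastropietro2006].
-/

noncomputable section

namespace Summit.HubbardSuperconductivity.HubbardSuperconductivity.Theorems.C4a

set_option linter.dupNamespace false -- summit = problem name (single-conjunct summit), D-0017

open Real Set
open Literature.MathematicalPhysics.QuantumLattice Literature.MathematicalPhysics.QuantumLattice.BandSectorCounting
open Summit.HubbardSuperconductivity.HubbardSuperconductivity.Theorems.DispersionFlow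
open Summit.HubbardSuperconductivity.HubbardSuperconductivity.Theorems.KLRegimeSplit
open Summit.HubbardSuperconductivity.HubbardSuperconductivity.Theorems.PerturbedFermiCurve

/-! ## §1 FS-adapted (co-moving) coordinates of the frame band -/

/-- **The level point `Φ_K(ρ, ϑ)`**: the point at polar angle `ϑ` on the level curve `{e_K = ε − μ − K = ρ}` — by definition the Fermi
point of the same frame at chemical potential `μ + ρ`, `toLp (klFermiPoint (μ + ρ) K ϑ)`.  `(ρ, ϑ)` are FST's radial/tangential coordinates
around the frame's Fermi curve `ρ = 0`. -/
def levelPoint (μ : ℝ) (K : TrigPolyC4v) (ρ ϑ : ℝ) : Momentum := WithLp.toLp 2 (klFermiPoint (μ + ρ) K ϑ)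

/-- At `ρ = 0` the level point is the frame's Fermi point. -/
theorem levelPoint_zero (μ : ℝ) (K : TrigPolyC4v) (ϑ : ℝ) : levelPoint μ K 0 ϑ = WithLp.toLp 2 (klFermiPoint μ K ϑ) := by
  simp [levelPoint]

/-- The frame band at `μ` is the frame band at `μ + ρ` plus `ρ`. -/
theorem frameLevel_eq_frameLevel_add (μ ρ : ℝ) (K : TrigPolyC4v) (x : Momentum) :
    frameLevel μ K x = frameLevel (μ + ρ) K x + ρ := by
  simp only [frameLevel]; ring

/-- **`e_K ∘ Φ(ρ, ·) ≡ ρ`**: the level point lies on the level-`ρ` curve, whenever the frame's `C²` size `A` keeps `[μ + ρ − A, μ + ρ + A]`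
inside a band range `[a, b]` carrying `B : BandBounds a b` (the hypotheses of `frameLevel_klFermiPoint` at `μ + ρ`). -/
theorem frameLevel_levelPoint {a b : ℝ} (B : BandBounds a b) {K : TrigPolyC4v} {A : ℝ}
    (hA : ∀ p : Momentum, ∀ j ≤ 2, ‖iteratedFDeriv ℝ j (frameShift K) p‖ ≤ A) {μ ρ : ℝ} (hlo : a ≤ μ + ρ - A)
    (hhi : μ + ρ + A ≤ b) (ϑ : ℝ) : frameLevel μ K (levelPoint μ K ρ ϑ) = ρ := by
  rw [frameLevel_eq_frameLevel_add μ ρ K, levelPoint, frameLevel_klFermiPoint B hA hlo hhi ϑ, zero_add]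

/-- **Central symmetry of the co-moving coordinates**: `Φ(ρ, ϑ + π) = −Φ(ρ, ϑ)`. -/
theorem levelPoint_add_pi (μ : ℝ) (K : TrigPolyC4v) (ρ ϑ : ℝ) : levelPoint μ K ρ (ϑ + π) = -levelPoint μ K ρ ϑ := by
  simp only [levelPoint, KLRegimeSplit.klFermiPoint_add_pi, WithLp.toLp_neg]

/-! ## §2 The co-moving reading of a two-momentum kernel -/

/-- **The co-moving reading** of a kernel `V(k, q)` (external leg `k`, loop leg `q`; values in `ℂ`): `t ↦ V(Φ(0, θ + t), Φ(ρ, ϑ + t))` — the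
external leg runs along the Fermi curve and the loop leg along its own level curve BY THE SAME ANGLE.  For a rotation-invariant band
and kernel it is constant; on the lattice its `t`-jets are what a tangential derivative of the one-slice tadpole sees (memo §2c). -/
def coMoving (μ : ℝ) (K : TrigPolyC4v) (V : Momentum → Momentum → ℂ) (θ ρ ϑ : ℝ) (t : ℝ) : ℂ :=
  V (levelPoint μ K 0 (θ + t)) (levelPoint μ K ρ (ϑ + t))

/-- Shifting the base angles is shifting `t`: `coMoving … θ ρ ϑ (s + t) = coMoving … (θ + s) ρ (ϑ + s) t`. -/
theorem coMoving_add (μ : ℝ) (K : TrigPolyC4v) (V : Momentum → Momentum → ℂ) (θ ρ ϑ s t : ℝ) :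
    coMoving μ K V θ ρ ϑ (s + t) = coMoving μ K V (θ + s) ρ (ϑ + s) t := by
  simp only [coMoving, add_assoc]

/-- **Exact softness**: a profile of the level read on the co-moving loop leg is constant — `f(e_K(Φ(ρ, ϑ + t))) = f ρ` for every `t`
(band hypotheses at `μ + ρ`).  This is why no tangential derivative ever lands on a slice propagator (a function of `(q₀, e_K(q))`). -/
theorem profile_coMoving_const {a b : ℝ} (B : BandBounds a b) {K : TrigPolyC4v} {A : ℝ}
    (hA : ∀ p : Momentum, ∀ j ≤ 2, ‖iteratedFDeriv ℝ j (frameShift K) p‖ ≤ A) {μ ρ : ℝ} (hlo : a ≤ μ + ρ - A)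
    (hhi : μ + ρ + A ≤ b) {X : Type*} (f : ℝ → X) (ϑ t : ℝ) :
    f (frameLevel μ K (levelPoint μ K ρ (ϑ + t))) = f ρ := by
  rw [frameLevel_levelPoint B hA hlo hhi]

/-- **The Cooper configuration co-moves**: with the loop leg's base angle antipodal to the external one (`ϑ = θ + π`) the loop leg is
`−Φ(ρ, θ + t)` for all `t` — the pair momentum `Φ(0, θ + t) − Φ(ρ, θ + t)` stays `O(ρ)`, it never sweeps through the Cooper singularity. -/
theorem coMoving_cooper (μ : ℝ) (K : TrigPolyC4v) (V : Momentum → Momentum → ℂ) (θ ρ t : ℝ) :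
    coMoving μ K V θ ρ (θ + π) t = V (levelPoint μ K 0 (θ + t)) (-levelPoint μ K ρ (θ + t)) := by
  simp only [coMoving]
  rw [show θ + π + t = (θ + t) + π by ring, levelPoint_add_pi]

/-! ## §3 The invariant: bounded co-moving jets -/

/-- **(J) `CoMovingJets A r μ K V`** — BOUNDED CO-MOVING JETS of the kernel `V` on the tube `|ρ| ≤ r`: for all base angles `θ, ϑ` and levels
`|ρ| ≤ r` the co-moving reading is `C⁴` in `t` and `‖∂ₜʲ coMoving … θ ρ ϑ‖ ≤ A j` at `t = 0` for `j ≤ 4` (hence at every `t`, `coMoving_add`).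
The constants `A j` are meant `n`-FREE along the induction (memo (J_n)): satisfied by the regular part of the explicit bubbles and of the
sign-resolved ladders (the co-moving field is tangent to `q = ±k` and to the caustic at the forward point), consumed by the tadpole-jet
lemma (L2); the umklapp-corner piece is NOT of this class and goes to (L4). -/
def CoMovingJets (A : ℕ → ℝ) (r : ℝ) (μ : ℝ) (K : TrigPolyC4v) (V : Momentum → Momentum → ℂ) : Prop :=
  ∀ θ ρ ϑ : ℝ, |ρ| ≤ r →
    ContDiff ℝ 4 (coMoving μ K V θ ρ ϑ) ∧ ∀ j : ℕ, j ≤ 4 → ‖iteratedDeriv j (coMoving μ K V θ ρ ϑ) 0‖ ≤ A j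

/-- The jet bound at `t = 0` for all base angles gives it at every `t`. -/
theorem CoMovingJets.norm_iteratedDeriv_le {A : ℕ → ℝ} {r μ : ℝ} {K : TrigPolyC4v} {V : Momentum → Momentum → ℂ}
    (h : CoMovingJets A r μ K V) {θ ρ ϑ : ℝ} (hρ : |ρ| ≤ r) {j : ℕ} (hj : j ≤ 4) (t : ℝ) :
    ‖iteratedDeriv j (coMoving μ K V θ ρ ϑ) t‖ ≤ A j := by
  have hfun : coMoving μ K V θ ρ ϑ = fun s => coMoving μ K V (θ + t) ρ (ϑ + t) (s - t) := by
    funext s; rw [← coMoving_add]; congr 1; ring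
  rw [hfun, iteratedDeriv_comp_sub_const]
  simp only [sub_self]
  exact (h (θ + t) ρ (ϑ + t) hρ).2 j hj

/-- A kernel with bounded co-moving jets of orders `≤ 4` and constants `A` has them with any larger constants. -/
theorem CoMovingJets.mono {A A' : ℕ → ℝ} {r μ : ℝ} {K : TrigPolyC4v} {V : Momentum → Momentum → ℂ}
    (h : CoMovingJets A r μ K V) (hAA' : ∀ j, j ≤ 4 → A j ≤ A' j) : CoMovingJets A' r μ K V :=
  fun θ ρ ϑ hρ => ⟨(h θ ρ ϑ hρ).1, fun j hj => ((h θ ρ ϑ hρ).2 j hj).trans (hAA' j hj)⟩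

/-- Co-moving jets are additive in the kernel (the fat vertex is a sum of channel pieces). -/
theorem CoMovingJets.add {A₁ A₂ : ℕ → ℝ} {r μ : ℝ} {K : TrigPolyC4v} {V₁ V₂ : Momentum → Momentum → ℂ}
    (h₁ : CoMovingJets A₁ r μ K V₁) (h₂ : CoMovingJets A₂ r μ K V₂) :
    CoMovingJets (fun j => A₁ j + A₂ j) r μ K (fun k q => V₁ k q + V₂ k q) := by
  intro θ ρ ϑ hρ
  obtain ⟨c₁, b₁⟩ := h₁ θ ρ ϑ hρ
  obtain ⟨c₂, b₂⟩ := h₂ θ ρ ϑ hρ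
  have hsum : coMoving μ K (fun k q => V₁ k q + V₂ k q) θ ρ ϑ = coMoving μ K V₁ θ ρ ϑ + coMoving μ K V₂ θ ρ ϑ := by
    funext t; simp [coMoving]
  refine ⟨by rw [hsum]; exact c₁.add c₂, fun j hj => ?_⟩
  rw [hsum, iteratedDeriv_add (c₁.contDiffAt.of_le (by exact_mod_cast hj)) (c₂.contDiffAt.of_le (by exact_mod_cast hj))]
  exact (norm_add_le _ _).trans (add_le_add (b₁ j hj) (b₂ j hj))

end Summit.HubbardSuperconductivity.HubbardSuperconductivity.Theorems.C4a
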